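import Summits.NavierStokesRegularity.TurbBounds.SpectralFormFreeSlip
import Summits.NavierStokesRegularity.TurbBounds.FSU1.Mode.M01Calculus
import Summits.NavierStokesRegularity.TurbBounds.FSU1.Mode.M03Defs

/-!
# FS-U1″ mode lemma — Parity (`TurbBounds/FSU1/Mode/M07Parity.lean`)

FS-PROOF-DRAFT §3.4–3.5: parity reduction of the full-cell form to the two half-cell classes — `parityReduction : ParityReduction`.

Cell-made mathematics of FS-PROOF-DRAFT §3 (pub-turb-sos), kernel-checked; generated from the design compose file
`StageF_compose.check.lean` (96c4b9bf…) by `build_mode_split.py`.  HONEST FRAMING: rigorous bounds for the stated PDE and boundary conditions; no claim about physical turbulence beyond the bound.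
-/

open Real intervalIntegral MeasureTheory Set

namespace Summit.NavierStokesRegularity.TurbBounds.FSU1.Mode

open Summit.NavierStokesRegularity.TurbBounds.SpectralFormFreeSlip

namespace PR

/-! ### 1. Reflection calculus -/

/-- Even and odd parts about `z = 1/2`. -/
noncomputable def evenPart (f : ℝ → ℝ) : ℝ → ℝ := fun z => (f z + f (1 - z)) / 2
/-- Odd part about the mid-plane: `(f(z) − f(1−z))/2`. -/
noncomputable def oddPart (f : ℝ → ℝ) : ℝ → ℝ := fun z => (f z - f (1 - z)) / 2

/-- `f = evenPart f + oddPart f`. -/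
theorem evenPart_add_oddPart (f : ℝ → ℝ) (z : ℝ) : evenPart f z + oddPart f z = f z := by
  unfold evenPart oddPart; ring

/-- `evenPart f (1−z) = evenPart f z`. -/
theorem evenPart_refl (f : ℝ → ℝ) (z : ℝ) : evenPart f (1 - z) = evenPart f z := by
  unfold evenPart; rw [sub_sub_cancel]; ring

/-- `oddPart f (1−z) = −oddPart f z`. -/
theorem oddPart_refl (f : ℝ → ℝ) (z : ℝ) : oddPart f (1 - z) = -oddPart f z := by
  unfold oddPart; rw [sub_sub_cancel]; ring

/-- Chain rule for the reflection `z ↦ f(1−z)`. -/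
theorem hasDerivAt_refl {f : ℝ → ℝ} (hf : Differentiable ℝ f) (z : ℝ) :
    HasDerivAt (fun x => f (1 - x)) (-deriv f (1 - z)) z := by
  have h := ((hf (1 - z)).hasDerivAt).comp z ((hasDerivAt_const z (1:ℝ)).sub (hasDerivAt_id z))
  have e : deriv f (1 - z) * (0 - 1) = -deriv f (1 - z) := by ring
  rw [e] at h; exact h

/-- `(evenPart f)′ = oddPart (f′)`. -/
theorem deriv_evenPart {f : ℝ → ℝ} (hf : Differentiable ℝ f) : deriv (evenPart f) = oddPart (deriv f) := by
  funext z
  have h := (((hf z).hasDerivAt).add (hasDerivAt_refl hf z)).div_const 2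
  have e : oddPart (deriv f) z = (deriv f z + -deriv f (1 - z)) / 2 := by unfold oddPart; ring
  rw [e]; exact h.deriv

/-- `(oddPart f)′ = evenPart (f′)`. -/
theorem deriv_oddPart {f : ℝ → ℝ} (hf : Differentiable ℝ f) : deriv (oddPart f) = evenPart (deriv f) := by
  funext z
  have h := (((hf z).hasDerivAt).sub (hasDerivAt_refl hf z)).div_const 2
  have e : evenPart (deriv f) z = (deriv f z - -deriv f (1 - z)) / 2 := by unfold evenPart; ring
  rw [e]; exact h.deriv

/-- `evenPart` preserves `C^n`. -/
theorem contDiff_evenPart {f : ℝ → ℝ} {n : WithTop ℕ∞} (hf : ContDiff ℝ n f) : ContDiff ℝ n (evenPart f) := by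
  unfold evenPart
  exact (hf.add (hf.comp (contDiff_const.sub contDiff_id))).div_const 2

/-- `oddPart` preserves `C^n`. -/
theorem contDiff_oddPart {f : ℝ → ℝ} {n : WithTop ℕ∞} (hf : ContDiff ℝ n f) : ContDiff ℝ n (oddPart f) := by
  unfold oddPart
  exact (hf.sub (hf.comp (contDiff_const.sub contDiff_id))).div_const 2

/-- `vort k` commutes with `evenPart`. -/
theorem vort_evenPart {v : ℝ → ℝ} (hv : ContDiff ℝ 3 v) (k : ℝ) : vort k (evenPart v) = evenPart (vort k v) := by
  obtain ⟨h1, h2, -⟩ := diff_pack hv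
  funext z
  unfold vort
  rw [deriv_evenPart h1, deriv_oddPart h2]
  unfold evenPart; ring

/-- `vort k` commutes with `oddPart`. -/
theorem vort_oddPart {v : ℝ → ℝ} (hv : ContDiff ℝ 3 v) (k : ℝ) : vort k (oddPart v) = oddPart (vort k v) := by
  obtain ⟨h1, h2, -⟩ := diff_pack hv
  funext z
  unfold vort
  rw [deriv_oddPart h1, deriv_evenPart h2]
  unfold oddPart; ring

/-! ### 2. Integral tools -/

/-- Reflection invariance on the unit interval: `∫₀¹ g(1−z) dz = ∫₀¹ g(z) dz`. -/
theorem integral_refl (g : ℝ → ℝ) : ∫ z in (0:ℝ)..1, g (1 - z) = ∫ z in (0:ℝ)..1, g z := by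
  have h := intervalIntegral.integral_comp_sub_left (a := 0) (b := 1) g 1
  rw [sub_self, sub_zero] at h; exact h

/-- A function odd about `z = 1/2` integrates to `0` over `[0,1]`. -/
theorem integral_odd_zero {g : ℝ → ℝ} (h : ∀ z, g (1 - z) = -g z) : ∫ z in (0:ℝ)..1, g z = 0 := by
  have h1 := integral_refl g
  simp_rw [h] at h1
  rw [intervalIntegral.integral_neg] at h1
  linarith

/-- A function even about `z = 1/2` has `∫₀¹ = 2∫₀^{1/2}`. -/
theorem integral_even_half {g : ℝ → ℝ} (h : ∀ z, g (1 - z) = g z) (h1 : IntervalIntegrable g volume 0 (1/2))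
    (h2 : IntervalIntegrable g volume (1/2) 1) :
    ∫ z in (0:ℝ)..1, g z = 2 * ∫ z in (0:ℝ)..1/2, g z := by
  rw [← intervalIntegral.integral_add_adjacent_intervals h1 h2]
  have h3 := intervalIntegral.integral_comp_sub_left (a := 0) (b := 1/2) g 1
  simp_rw [h] at h3
  norm_num at h3
  rw [← h3]; ring

/-- Interval integrals agree when the integrands agree on the open interval off a finite set. -/
theorem integral_congr_off {f g : ℝ → ℝ} {a b : ℝ} {S : Set ℝ} (hS : S.Finite) (hab : a ≤ b)
    (h : ∀ x ∈ Ioo a b, x ∉ S → f x = g x) : ∫ x in a..b, f x = ∫ x in a..b, g x := by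
  apply intervalIntegral.integral_congr_ae
  have hN : volume (S ∪ {b}) = 0 := (hS.union (Set.finite_singleton b)).measure_zero volume
  have hae := measure_eq_zero_iff_ae_notMem.1 hN
  filter_upwards [hae] with x hx hxI
  rw [uIoc_of_le hab] at hxI
  simp only [Set.mem_union, Set.mem_singleton_iff, not_or] at hx
  exact h x ⟨hxI.1, lt_of_le_of_ne hxI.2 hx.2⟩ hx.1

/-! ### 3. The exact two-layer step profile -/

/-- `tau0 δ z = −1/(2δ)` for `z < δ` or `z > 1 − δ`, else `0`. -/
noncomputable def tau0 (δ : ℝ) (z : ℝ) : ℝ := if z < δ ∨ 1 - δ < z then -(1 / (2 * δ)) else 0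

/-- The profile derivative `τ′` of FS-U1″ is even about the mid-plane. -/
theorem tau0_refl (δ z : ℝ) : tau0 δ (1 - z) = tau0 δ z := by
  unfold tau0
  have e : (1 - z < δ ∨ 1 - δ < 1 - z) ↔ (z < δ ∨ 1 - δ < z) := by
    constructor
    · rintro (h | h)
      · right; linarith
      · left; linarith
    · rintro (h | h)
      · right; linarith
      · left; linarith
  simp only [e]

/-- `τ′ = −1/(2δ)` on the bottom layer `z < δ`. -/
theorem tau0_of_lt {δ z : ℝ} (h : z < δ) : tau0 δ z = -(1 / (2 * δ)) := by
  unfold tau0; simp [h]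

/-- `τ′ = 0` in the bulk `δ < z < 1−δ`. -/
theorem tau0_of_mid {δ z : ℝ} (h1 : δ ≤ z) (h2 : z ≤ 1 - δ) : tau0 δ z = 0 := by
  unfold tau0
  have : ¬ (z < δ ∨ 1 - δ < z) := by
    rintro (h | h) <;> linarith
  simp [this]

/-- `τ′` is measurable. -/
theorem measurable_tau0 (δ : ℝ) : Measurable (tau0 δ) := by
  have hS : MeasurableSet {x : ℝ | x < δ ∨ 1 - δ < x} := by
    have : {x : ℝ | x < δ ∨ 1 - δ < x} = Set.Iio δ ∪ Set.Ioi (1 - δ) := by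
      ext x; simp
    rw [this]; exact measurableSet_Iio.union measurableSet_Ioi
  unfold tau0
  exact Measurable.ite hS measurable_const measurable_const

/-- `|τ′| ≤ 1/(2δ)`. -/
theorem abs_tau0_le (δ z : ℝ) (hδ : 0 < δ) : |tau0 δ z| ≤ 1 / (2 * δ) := by
  unfold tau0
  split_ifs
  · rw [abs_neg, abs_of_pos (by positivity)]
  · simp only [abs_zero]; positivity

/-- `τ′` is interval-integrable. -/
theorem intervalIntegrable_tau0 (δ a b : ℝ) (hδ : 0 < δ) : IntervalIntegrable (tau0 δ) volume a b := by
  refine IntervalIntegrable.mono_fun' (g := fun _ => 1 / (2 * δ)) intervalIntegrable_const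
    (measurable_tau0 δ).aestronglyMeasurable ?_
  exact Filter.Eventually.of_forall (fun z => by simpa [Real.norm_eq_abs] using abs_tau0_le δ z hδ)

/-- `τ′·g` is interval-integrable for continuous `g`. -/
theorem intervalIntegrable_tau0_mul {δ : ℝ} (hδ : 0 < δ) {f : ℝ → ℝ} (hf : Continuous f) (a b : ℝ) :
    IntervalIntegrable (fun z => tau0 δ z * f z) volume a b :=
  (intervalIntegrable_tau0 δ a b hδ).mul_continuousOn hf.continuousOn

/-- `τ′ = −1/(2δ)` on the top layer `z > 1−δ`. -/
theorem tau0_of_gt {δ z : ℝ} (h : 1 - δ < z) : tau0 δ z = -(1 / (2 * δ)) := by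
  unfold tau0; simp [h]

/-! ### 4. The `E₁` integrand, integrability, the half-cell identity and the parity split -/

/-- The `E₁` integrand. -/
noncomputable def F1 (α β₀ : ℝ) (τ : ℝ → ℝ) (k : ℝ) (v θ : ℝ → ℝ) (z : ℝ) : ℝ :=
  deriv θ z ^ 2 + α * deriv (vort k v) z ^ 2 + (α * k ^ 2 + β₀) * vort k v z ^ 2 + 2 * τ z * v z * θ z

/-- `E₁ = ∫₀¹ F₁` (definitional unfolding of the density). -/
theorem E1_eq (α β₀ : ℝ) (τ : ℝ → ℝ) (k : ℝ) (v θ : ℝ → ℝ) :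
    E1 α β₀ τ k v θ = ∫ z in (0:ℝ)..1, F1 α β₀ τ k v θ z := rfl

/-- The quadratic part of the density of `E₁` is continuous for a `FreeSlipPair`. -/
theorem continuous_Q {α β₀ k : ℝ} {V Θ : ℝ → ℝ} (hV : ContDiff ℝ 3 V) (hΘ : ContDiff ℝ 1 Θ) :
    Continuous fun z => deriv Θ z ^ 2 + α * deriv (vort k V) z ^ 2 + (α * k ^ 2 + β₀) * vort k V z ^ 2 := by
  have c1 : Continuous (deriv Θ) := hΘ.continuous_deriv le_rfl
  have c2 : Continuous (deriv (vort k V)) := continuous_deriv_vort hV k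
  have c3 : Continuous (vort k V) := (differentiable_vort hV k).continuous
  exact ((c1.pow 2).add (continuous_const.mul (c2.pow 2))).add (continuous_const.mul (c3.pow 2))

/-- The density `F₁` of `E₁` is interval-integrable on `[0,1]` for a `FreeSlipPair`. -/
theorem F1_integrable {α β₀ δ k : ℝ} (hδ : 0 < δ) {V Θ : ℝ → ℝ} (hV : ContDiff ℝ 3 V) (hΘ : ContDiff ℝ 1 Θ)
    (a b : ℝ) : IntervalIntegrable (F1 α β₀ (tau0 δ) k V Θ) volume a b := by
  have cQ := continuous_Q (α := α) (β₀ := β₀) (k := k) hV hΘ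
  have cP : Continuous fun z => 2 * V z * Θ z := (continuous_const.mul hV.continuous).mul hΘ.continuous
  have iT := intervalIntegrable_tau0_mul hδ cP a b
  have e : F1 α β₀ (tau0 δ) k V Θ = fun z =>
      (deriv Θ z ^ 2 + α * deriv (vort k V) z ^ 2 + (α * k ^ 2 + β₀) * vort k V z ^ 2)
        + tau0 δ z * (2 * V z * Θ z) := by
    funext z; unfold F1; ring
  rw [e]; exact (cQ.intervalIntegrable _ _).add iT

/-- Half-cell identity: for a pair whose quadratic integrand and product `VΘ` are even about `1/2`,
`E₁(τ₀; V, Θ) = 2·E_half(V, Θ)`. -/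
theorem E1_half {α β₀ δ k : ℝ} (hδ : 0 < δ) (hδh : δ ≤ 1 / 2) {V Θ : ℝ → ℝ} (hV : ContDiff ℝ 3 V)
    (hΘ : ContDiff ℝ 1 Θ)
    (hQ : ∀ z, deriv Θ (1 - z) ^ 2 + α * deriv (vort k V) (1 - z) ^ 2 + (α * k ^ 2 + β₀) * vort k V (1 - z) ^ 2
        = deriv Θ z ^ 2 + α * deriv (vort k V) z ^ 2 + (α * k ^ 2 + β₀) * vort k V z ^ 2)
    (hP : ∀ z, V (1 - z) * Θ (1 - z) = V z * Θ z) :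
    E1 α β₀ (tau0 δ) k V Θ = 2 * Eh α β₀ δ k V Θ := by
  have cQ := continuous_Q (α := α) (β₀ := β₀) (k := k) hV hΘ
  have cVΘ : Continuous fun z => V z * Θ z := hV.continuous.mul hΘ.continuous
  have cP : Continuous fun z => 2 * (V z * Θ z) := continuous_const.mul cVΘ
  have iC : ∀ a b, IntervalIntegrable (fun z => tau0 δ z * (2 * (V z * Θ z))) volume a b :=
    fun a b => intervalIntegrable_tau0_mul hδ cP a b
  -- split E₁ = ∫ Q + ∫ C
  have e : F1 α β₀ (tau0 δ) k V Θ = fun z =>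
      (deriv Θ z ^ 2 + α * deriv (vort k V) z ^ 2 + (α * k ^ 2 + β₀) * vort k V z ^ 2)
        + tau0 δ z * (2 * (V z * Θ z)) := by
    funext z; unfold F1; ring
  rw [E1_eq, e, intervalIntegral.integral_add (cQ.intervalIntegrable _ _) (iC 0 1)]
  -- quadratic part: even
  rw [integral_even_half hQ (cQ.intervalIntegrable _ _) (cQ.intervalIntegrable _ _)]
  -- coupling part: even, then localised on [0, δ]
  have hCe : ∀ z, tau0 δ (1 - z) * (2 * (V (1 - z) * Θ (1 - z))) = tau0 δ z * (2 * (V z * Θ z)) := by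
    intro z; rw [tau0_refl, hP]
  rw [integral_even_half hCe (iC _ _) (iC _ _)]
  rw [← intervalIntegral.integral_add_adjacent_intervals (iC 0 δ) (iC δ (1/2))]
  have p1 : ∫ z in (0:ℝ)..δ, tau0 δ z * (2 * (V z * Θ z)) = -(1 / δ) * ∫ z in (0:ℝ)..δ, V z * Θ z := by
    rw [← intervalIntegral.integral_const_mul]
    apply integral_congr_off (S := ∅) Set.finite_empty hδ.le
    intro x hx _
    rw [tau0_of_lt hx.2]; field_simp
  have p2 : ∫ z in δ..1/2, tau0 δ z * (2 * (V z * Θ z)) = 0 := by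
    have : ∫ z in δ..1/2, tau0 δ z * (2 * (V z * Θ z)) = ∫ z in δ..1/2, (0:ℝ) := by
      apply integral_congr_off (S := ∅) Set.finite_empty hδh
      intro x hx _
      rw [tau0_of_mid hx.1.le (by linarith [hx.2])]; ring
    rw [this]; simp
  rw [p1, p2]
  unfold Eh
  ring

/-- Parity split: `E₁(v, θ) = E₁(v₊, θ₊) + E₁(v₋, θ₋)` (the cross integrand is odd about `1/2`). -/
theorem E1_split {α β₀ δ k : ℝ} (hδ : 0 < δ) {v θ : ℝ → ℝ} (hv : ContDiff ℝ 3 v) (hθ : ContDiff ℝ 1 θ) :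
    E1 α β₀ (tau0 δ) k v θ
      = E1 α β₀ (tau0 δ) k (evenPart v) (evenPart θ) + E1 α β₀ (tau0 δ) k (oddPart v) (oddPart θ) := by
  obtain ⟨hv1, hv2, hv3⟩ := diff_pack hv
  have hθ1 : Differentiable ℝ θ := hθ.differentiable (by norm_num)
  have hΩ1 : Differentiable ℝ (vort k v) := differentiable_vort hv k
  -- derivative / vorticity formulas for the parts
  have dp : deriv (evenPart θ) = oddPart (deriv θ) := deriv_evenPart hθ1
  have dq : deriv (oddPart θ) = evenPart (deriv θ) := deriv_oddPart hθ1
  have Ωe : vort k (evenPart v) = evenPart (vort k v) := vort_evenPart hv k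
  have Ωo : vort k (oddPart v) = oddPart (vort k v) := vort_oddPart hv k
  have dΩe : deriv (vort k (evenPart v)) = oddPart (deriv (vort k v)) := by rw [Ωe]; exact deriv_evenPart hΩ1
  have dΩo : deriv (vort k (oddPart v)) = evenPart (deriv (vort k v)) := by rw [Ωo]; exact deriv_oddPart hΩ1
  have dΩe' : deriv (evenPart (vort k v)) = oddPart (deriv (vort k v)) := deriv_evenPart hΩ1
  have dΩo' : deriv (oddPart (vort k v)) = evenPart (deriv (vort k v)) := deriv_oddPart hΩ1
  -- the cross integrand
  set X : ℝ → ℝ := fun z => 2 * oddPart (deriv θ) z * evenPart (deriv θ) z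
      + 2 * α * oddPart (deriv (vort k v)) z * evenPart (deriv (vort k v)) z
      + 2 * (α * k ^ 2 + β₀) * evenPart (vort k v) z * oddPart (vort k v) z
      + 2 * tau0 δ z * (evenPart v z * oddPart θ z + oddPart v z * evenPart θ z) with hX
  have hXodd : ∀ z, X (1 - z) = -X z := by
    intro z
    simp only [hX, evenPart_refl, oddPart_refl, tau0_refl]
    ring
  have hpt : ∀ z, F1 α β₀ (tau0 δ) k v θ z
      = F1 α β₀ (tau0 δ) k (evenPart v) (evenPart θ) z + F1 α β₀ (tau0 δ) k (oddPart v) (oddPart θ) z + X z := by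
    intro z
    simp only [F1, dp, dq, Ωe, Ωo, dΩe', dΩo', hX]
    have e1 : deriv θ z = evenPart (deriv θ) z + oddPart (deriv θ) z := (evenPart_add_oddPart _ _).symm
    have e2 : vort k v z = evenPart (vort k v) z + oddPart (vort k v) z := (evenPart_add_oddPart _ _).symm
    have e3 : deriv (vort k v) z = evenPart (deriv (vort k v)) z + oddPart (deriv (vort k v)) z :=
      (evenPart_add_oddPart _ _).symm
    have e4 : v z = evenPart v z + oddPart v z := (evenPart_add_oddPart _ _).symm
    have e5 : θ z = evenPart θ z + oddPart θ z := (evenPart_add_oddPart _ _).symm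
    rw [e1, e2, e3]
    conv_lhs => rw [e4, e5]
    ring
  have Ie := F1_integrable (α := α) (β₀ := β₀) (k := k) hδ (contDiff_evenPart hv) (contDiff_evenPart hθ) 0 1
  have Io := F1_integrable (α := α) (β₀ := β₀) (k := k) hδ (contDiff_oddPart hv) (contDiff_oddPart hθ) 0 1
  have IX : IntervalIntegrable X volume 0 1 := by
    have I := F1_integrable (α := α) (β₀ := β₀) (k := k) hδ hv hθ 0 1
    have e : X = fun z => F1 α β₀ (tau0 δ) k v θ z
        - (F1 α β₀ (tau0 δ) k (evenPart v) (evenPart θ) z + F1 α β₀ (tau0 δ) k (oddPart v) (oddPart θ) z) := by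
      funext z; rw [hpt z]; ring
    rw [e]; exact I.sub (Ie.add Io)
  rw [E1_eq, E1_eq, E1_eq]
  have hc : ∫ z in (0:ℝ)..1, F1 α β₀ (tau0 δ) k v θ z
      = ∫ z in (0:ℝ)..1, ((F1 α β₀ (tau0 δ) k (evenPart v) (evenPart θ) z
          + F1 α β₀ (tau0 δ) k (oddPart v) (oddPart θ) z) + X z) :=
    intervalIntegral.integral_congr (fun z _ => hpt z)
  rw [hc, intervalIntegral.integral_add (Ie.add Io) IX, intervalIntegral.integral_add Ie Io,
    integral_odd_zero hXodd]
  ring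

end PR

open PR in
/-- FS-PROOF-DRAFT §3.4–3.5: `E₁(v,θ) = E_half(even parts) + E_half(odd parts)` up to the symmetry `z ↦ 1−z`, with the even/odd parts in the classes `HalfEven`/`HalfOdd`; hence `E₁ ≥ 0` follows from the two half-cell statements. PROVED. -/
theorem parityReduction : ParityReduction := by
  intro α β₀ δ k τp hα hβ hδ hδh hk hτ1 hτ2 hτ3 hEven hOdd v θ hp
  -- Step 0: replace τp by the exact step profile
  have step0 : E1 α β₀ τp k v θ = E1 α β₀ (tau0 δ) k v θ := by
    rw [E1_eq, E1_eq]
    apply integral_congr_off (S := {δ, 1 - δ}) ((Set.finite_singleton (1 - δ)).insert δ) zero_le_one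
    intro x hx hxS
    simp only [Set.mem_insert_iff, Set.mem_singleton_iff, not_or] at hxS
    have hτ : τp x = tau0 δ x := by
      rcases lt_or_gt_of_ne hxS.1 with h1 | h1
      · rw [hτ1 ⟨hx.1, h1⟩, tau0_of_lt h1]
      · rcases lt_or_gt_of_ne hxS.2 with h2 | h2
        · rw [hτ2 ⟨h1, h2⟩, tau0_of_mid h1.le h2.le]
        · rw [hτ3 ⟨h2, hx.2⟩, tau0_of_gt h2]
    unfold F1; rw [hτ]
  rw [step0, E1_split hδ hp.hv hp.hθ]
  obtain ⟨hv1, hv2, hv3⟩ := diff_pack hp.hv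
  have hθ1 : Differentiable ℝ θ := hp.hθ.differentiable (by norm_num)
  have hΩ1 : Differentiable ℝ (vort k v) := differentiable_vort hp.hv k
  -- memberships
  have hE : HalfEven (evenPart v) (evenPart θ) := by
    refine ⟨contDiff_evenPart hp.hv, contDiff_evenPart hp.hθ, ?_, ?_, ?_, ?_, ?_⟩
    · show (v 0 + v (1 - 0)) / 2 = 0
      rw [sub_zero, hp.v_bot, hp.v_top]; norm_num
    · rw [deriv_evenPart hv1, deriv_oddPart hv2]
      show (deriv (deriv v) 0 + deriv (deriv v) (1 - 0)) / 2 = 0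
      rw [sub_zero, hp.ddv_bot, hp.ddv_top]; norm_num
    · show (θ 0 + θ (1 - 0)) / 2 = 0
      rw [sub_zero, hp.θ_bot, hp.θ_top]; norm_num
    · rw [deriv_evenPart hv1]
      show (deriv v (1 / 2) - deriv v (1 - 1 / 2)) / 2 = 0
      norm_num
    · rw [deriv_evenPart hv1, deriv_oddPart hv2, deriv_evenPart hv3]
      show (deriv (deriv (deriv v)) (1 / 2) - deriv (deriv (deriv v)) (1 - 1 / 2)) / 2 = 0
      norm_num
  have hO : HalfOdd (oddPart v) (oddPart θ) := by
    refine ⟨contDiff_oddPart hp.hv, contDiff_oddPart hp.hθ, ?_, ?_, ?_, ?_, ?_, ?_⟩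
    · show (v 0 - v (1 - 0)) / 2 = 0
      rw [sub_zero, hp.v_bot, hp.v_top]; norm_num
    · rw [deriv_oddPart hv1, deriv_evenPart hv2]
      show (deriv (deriv v) 0 - deriv (deriv v) (1 - 0)) / 2 = 0
      rw [sub_zero, hp.ddv_bot, hp.ddv_top]; norm_num
    · show (θ 0 - θ (1 - 0)) / 2 = 0
      rw [sub_zero, hp.θ_bot, hp.θ_top]; norm_num
    · show (v (1 / 2) - v (1 - 1 / 2)) / 2 = 0
      norm_num
    · rw [deriv_oddPart hv1, deriv_evenPart hv2]
      show (deriv (deriv v) (1 / 2) - deriv (deriv v) (1 - 1 / 2)) / 2 = 0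
      norm_num
    · show (θ (1 / 2) - θ (1 - 1 / 2)) / 2 = 0
      norm_num
  -- half-cell identities
  have dp : deriv (evenPart θ) = oddPart (deriv θ) := deriv_evenPart hθ1
  have dq : deriv (oddPart θ) = evenPart (deriv θ) := deriv_oddPart hθ1
  have Ωe : vort k (evenPart v) = evenPart (vort k v) := vort_evenPart hp.hv k
  have Ωo : vort k (oddPart v) = oddPart (vort k v) := vort_oddPart hp.hv k
  have dΩe : deriv (vort k (evenPart v)) = oddPart (deriv (vort k v)) := by rw [Ωe]; exact deriv_evenPart hΩ1
  have dΩo : deriv (vort k (oddPart v)) = evenPart (deriv (vort k v)) := by rw [Ωo]; exact deriv_oddPart hΩ1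
  have hQe : ∀ z, deriv (evenPart θ) (1 - z) ^ 2 + α * deriv (vort k (evenPart v)) (1 - z) ^ 2
        + (α * k ^ 2 + β₀) * vort k (evenPart v) (1 - z) ^ 2
      = deriv (evenPart θ) z ^ 2 + α * deriv (vort k (evenPart v)) z ^ 2
        + (α * k ^ 2 + β₀) * vort k (evenPart v) z ^ 2 := by
    intro z; rw [dp, dΩe, Ωe, oddPart_refl, oddPart_refl, evenPart_refl]; ring
  have hPe : ∀ z, evenPart v (1 - z) * evenPart θ (1 - z) = evenPart v z * evenPart θ z := by
    intro z; rw [evenPart_refl, evenPart_refl]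
  have hQo : ∀ z, deriv (oddPart θ) (1 - z) ^ 2 + α * deriv (vort k (oddPart v)) (1 - z) ^ 2
        + (α * k ^ 2 + β₀) * vort k (oddPart v) (1 - z) ^ 2
      = deriv (oddPart θ) z ^ 2 + α * deriv (vort k (oddPart v)) z ^ 2
        + (α * k ^ 2 + β₀) * vort k (oddPart v) z ^ 2 := by
    intro z; rw [dq, dΩo, Ωo, evenPart_refl, evenPart_refl, oddPart_refl]; ring
  have hPo : ∀ z, oddPart v (1 - z) * oddPart θ (1 - z) = oddPart v z * oddPart θ z := by
    intro z; rw [oddPart_refl, oddPart_refl]; ring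
  rw [E1_half hδ hδh (contDiff_evenPart hp.hv) (contDiff_evenPart hp.hθ) hQe hPe,
    E1_half hδ hδh (contDiff_oddPart hp.hv) (contDiff_oddPart hp.hθ) hQo hPo]
  have h1 := hEven _ _ hE
  have h2 := hOdd _ _ hO
  linarith

end Summit.NavierStokesRegularity.TurbBounds.FSU1.Mode
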